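import Summits.CriticalPhenomena.SAWScalingLimit.Theorems.SAWLoopFugacityFlowSimpleSubseqLimitsRouteResidual
import Summits.CriticalPhenomena.SAWScalingLimit.Theorems.SimpleSubseqLimits.Negative.SimpleSubseqLimitsHypothesisLedger
import HarnessLib

/-!
# The EXPONENT INTERFACE of the ORDER input: a sub-area one-point bound on localised past/future
# returns implies first-entrance slit avoidance (crux stmt-CriticalPhenomena-4982, decl
`Summit.CriticalPhenomena.SAWScalingLimit.Theses.SAWLoopFugacityFlow.SimpleSubseqLimits`; line
`past-shadowing-costs-halves` v4; line lead c5, 2026-08-17)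

The residual of the crux is the qualitative decay statement `PastFutureAvoidance` (for every ball and
target `θ` SOME width `ε` works). Lattice progress on critical exponents, if it ever comes, arrives in a
different currency: a ONE-POINT bound "the probability that the walk produces a first-entrance past/future
return with BOTH strands inside the small ball `B(z, ρ)` is `≤ C ρ^{2+c}`" (the near-double-point
exponent; SLE_{8/3}/Coulomb-gas value `2 + c = 35/12`, i.e. `c = 11/12`). This file converts that
currency into the crux's:

* `LocalPastFutureReturn γ q r r' z ρ` — the past/future return configuration of `FarPast.Line` with both
  the past value `γ v` and the returning value `γ t'` localised in `B(z, ρ)`;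
* `LocalReturnDecayAt D a b` — SUB-AREA decay: for every `(q, r)` some `r' ∈ (r, 5r]` such that for every
  `θ > 0` and all small `ρ`, for every centre `z`, eventually in `δ`, `P_δ[LocalPastFutureReturn … z ρ] ≤ θ ρ²`
  ("o(ρ²) uniformly in the centre": the exponent exceeds the dimension `2` of the ambient net);
  `LocalReturnDecay` — along every endpoint approximation;
* `pastFutureAvoidanceAt_of_localReturnDecayAt` — **`LocalReturnDecayAt D a b → PastFutureAvoidanceAt D a b`**
  (union bound over the `ε`-grid of a square containing `closure D`: `≍ (2R+3)²/ε²` centres, each charged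
  `≤ θ' (2ε)²`; lattice polylines live in `closure D`, `Negative.curve_range_subset_closure`);
* `localReturnDecayAt_of_powerBound` — any power bound `C ρ^{2+c}`, `c > 0`, gives the sub-area decay;
* corollaries: `pastFutureAvoidance_of_localReturnDecay`, `simpleSubseqLimits_of_localReturnDecay`
  (`+ BoundaryDecay`, A-side-free) and `simpleSubseqLimits_of_localReturnDecay_avoidanceLimit` (`+` the
  A-side crux, inside the routes), `sawScalingLimit_of_localReturnDecay` (`+ AvoidanceLimit + EventualTight`).

Unlike `PastFutureAvoidance`, the exponent-type input is NOT implied by the summit conjecture (a scaling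
limit carries no rates): it is a strictly stronger, conjecturally true (margin `11/12`) lattice statement,
recorded here only as the interface through which a quantitative lattice result would close the crux.
-/

noncomputable section

open MeasureTheory Filter Topology Set Metric Function
open Literature.Probability.RandomPlanarGeometry Literature.Probability.RandomPlanarGeometry.SAW
open Literature.Probability.LatticeModels
open scoped ENNReal NNReal BoundedContinuousFunction unitInterval

namespace Summit.CriticalPhenomena.SAWScalingLimit.Theorems.SimpleSubseqLimits.FarPast.Exponent

open Summit.CriticalPhenomena.SAWScalingLimit.Theses.SAWLoopFugacityFlow
  (SimpleSubseqLimits AvoidanceLimit EventualTight)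
open Summit.CriticalPhenomena.SAWScalingLimit.Theorems.SimpleSubseqLimits.Negative
  (curve_range_subset_closure eventually_ne_nhdsGT)
open Summit.CriticalPhenomena.SAWScalingLimit.Theorems.SimpleSubseqLimits.MarkedPointRevisit.Passage
  (latticeCurve mk_latticeCurve)
open Summit.CriticalPhenomena.SAWScalingLimit.Theorems.SimpleSubseqLimits.Boundary.Passage (BoundaryDecay)
open Summit.CriticalPhenomena.SAWScalingLimit.Theorems.SimpleSubseqLimits.FarPast.Line
  (PastFutureReturn PastFutureAvoidanceAt PastFutureAvoidance simpleSubseqLimits_of_pastFutureAvoidance)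
open Summit.CriticalPhenomena.SAWScalingLimit.Theorems.SimpleSubseqLimits.FarPast.RouteResidual
  (line_pastFuture_avoidanceLimit sawScalingLimit_of_three_inputs)

variable {D : DobrushinDomain} {a b : ℝ → Site 2}

/-! ## §1 Vocabulary -/

/-- **Localised past/future return**: the past/future return configuration at the first entrance into
`B̄(q, r')` (`FarPast.Line.PastFutureReturn`) with BOTH the far-past value `γ v` and the returning value
`γ t'` inside the ball `B(z, ρ)`. -/
def LocalPastFutureReturn (γ : Curve ℂ) (q : ℂ) (r r' : ℝ) (z : ℂ) (ρ : ℝ) : Prop :=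
  ∃ v τ t' : I, v < τ ∧ τ ≤ t' ∧ γ τ ∈ closedBall q r' ∧ (∀ u : I, u < τ → γ u ∉ closedBall q r') ∧
    (∀ u : I, u ≤ v → 5 * r < dist (γ u) q) ∧ dist (γ v) z < ρ ∧ dist (γ t') z < ρ

/-- **Sub-area decay of localised past/future returns at `(D; a_δ, b_δ)`** (the exponent-type form of the
ORDER input): for every centre `q` and radius `r > 0` there is an entrance radius `r' ∈ (r, 5r]` such that
for every `θ > 0` there is `ρ₀ > 0` with: for all `ρ ∈ (0, ρ₀)` and every `z ∈ ℂ`, eventually as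
`δ → 0⁺`, the critical SAW law charges the localised return at `(z, ρ)` at most `θ ρ²`. Any uniform power
bound `C ρ^{2+c}` with `c > 0` implies it (`localReturnDecayAt_of_powerBound`). An open lattice statement,
STRONGER than the crux's residual (not implied by the summit conjecture); untagged. -/
def LocalReturnDecayAt (D : DobrushinDomain) (a b : ℝ → Site 2) : Prop :=
  ∀ (q : ℂ) (r : ℝ), 0 < r → ∃ r' : ℝ, r < r' ∧ r' ≤ 5 * r ∧ ∀ θ : ℝ, 0 < θ → ∃ ρ₀ : ℝ, 0 < ρ₀ ∧
    ∀ ρ : ℝ, 0 < ρ → ρ < ρ₀ → ∀ z : ℂ, ∀ᶠ δ in 𝓝[>] (0 : ℝ),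
      SAW.law D.carrier δ (a δ) (b δ) {γ | LocalPastFutureReturn (latticeCurve γ) q r r' z ρ} ≤
        ENNReal.ofReal (θ * ρ ^ 2)

/-- Sub-area decay of localised past/future returns along every endpoint approximation (open,
untagged; sufficient for `PastFutureAvoidance`). -/
def LocalReturnDecay : Prop :=
  ∀ (D : DobrushinDomain) (a b : ℝ → Site 2), SAW.IsEndpointApprox D a b → LocalReturnDecayAt D a b

/-! ## §2 The `ε`-grid of a square -/

/-- The `ε`-grid points `ε (i + j I)`, `|i|, |j| ≤ n`. -/
def grid (ε : ℝ) (n : ℕ) : Finset ℂ :=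
  ((Finset.Icc (-(n : ℤ)) n) ×ˢ (Finset.Icc (-(n : ℤ)) n)).image
    fun p => Complex.mk (ε * (p.1 : ℝ)) (ε * (p.2 : ℝ))

/-- The grid has at most `(2n+1)²` points. [folklore] -/
theorem card_grid_le (ε : ℝ) (n : ℕ) : ((grid ε n).card : ℝ) ≤ (2 * n + 1) ^ 2 := by
  have h : (grid ε n).card ≤ (2 * n + 1) ^ 2 := by
    refine (Finset.card_image_le).trans ?_
    rw [Finset.card_product, Int.card_Icc]
    have : (↑n + 1 - -(n : ℤ)).toNat = 2 * n + 1 := by omega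
    rw [this, sq]
  exact_mod_cast h

/-- Rounding a real of modulus `≤ n` gives an integer in `[-n, n]`. [folklore] -/
theorem round_mem_Icc {x : ℝ} {n : ℕ} (hx : |x| ≤ n) : round x ∈ Finset.Icc (-(n : ℤ)) n := by
  have h := abs_sub_round x
  rw [abs_le] at hx h
  rw [Finset.mem_Icc]
  constructor
  · have : (-(n : ℤ) : ℝ) - 1 < round x := by push_cast; linarith
    have : -(n : ℤ) - 1 < round x := by exact_mod_cast this
    omega
  · have : (round x : ℝ) < (n : ℤ) + 1 := by push_cast; linarith
    have : round x < (n : ℤ) + 1 := by exact_mod_cast this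
    omega

/-- **Covering.** Every point of norm `≤ R` is within distance `< ε` of the `ε`-grid with `n ≥ R/ε`
(nearest grid point: coordinatewise rounding, error `≤ ε/2` per coordinate, `√2/2 < 1`). [folklore] -/
theorem exists_mem_grid_dist_lt {ε R : ℝ} {n : ℕ} (hε : 0 < ε) (hn : R ≤ ε * n) {w : ℂ}
    (hw : ‖w‖ ≤ R) : ∃ z ∈ grid ε n, dist w z < ε := by
  set i : ℤ := round (w.re / ε) with hi
  set j : ℤ := round (w.im / ε) with hj
  have hre : |w.re / ε| ≤ n := by
    rw [abs_div, abs_of_pos hε, div_le_iff₀ hε]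
    calc |w.re| ≤ ‖w‖ := Complex.abs_re_le_norm w
      _ ≤ ε * n := hw.trans hn
      _ = ↑n * ε := mul_comm _ _
  have him : |w.im / ε| ≤ n := by
    rw [abs_div, abs_of_pos hε, div_le_iff₀ hε]
    calc |w.im| ≤ ‖w‖ := Complex.abs_im_le_norm w
      _ ≤ ε * n := hw.trans hn
      _ = ↑n * ε := mul_comm _ _
  refine ⟨Complex.mk (ε * (i : ℝ)) (ε * (j : ℝ)), ?_, ?_⟩
  · exact Finset.mem_image.2 ⟨(i, j), Finset.mem_product.2 ⟨round_mem_Icc hre, round_mem_Icc him⟩, rfl⟩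
  · rw [dist_eq_norm]
    have h1 : |(w - Complex.mk (ε * (i : ℝ)) (ε * (j : ℝ))).re| ≤ ε / 2 := by
      have h := abs_sub_round (w.re / ε)
      simp only [Complex.sub_re]
      have : w.re - ε * (i : ℝ) = ε * (w.re / ε - round (w.re / ε)) := by
        rw [hi]; field_simp
      rw [this, abs_mul, abs_of_pos hε]
      nlinarith
    have h2 : |(w - Complex.mk (ε * (i : ℝ)) (ε * (j : ℝ))).im| ≤ ε / 2 := by
      have h := abs_sub_round (w.im / ε)
      simp only [Complex.sub_im]
      have : w.im - ε * (j : ℝ) = ε * (w.im / ε - round (w.im / ε)) := by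
        rw [hj]; field_simp
      rw [this, abs_mul, abs_of_pos hε]
      nlinarith
    have hmax : max |(w - Complex.mk (ε * (i : ℝ)) (ε * (j : ℝ))).re|
        |(w - Complex.mk (ε * (i : ℝ)) (ε * (j : ℝ))).im| ≤ ε / 2 := max_le h1 h2
    have hsqrt : Real.sqrt 2 < 2 := by
      rw [show (2 : ℝ) = Real.sqrt 4 by
        rw [show (4 : ℝ) = 2 ^ 2 by norm_num, Real.sqrt_sq (by norm_num : (0 : ℝ) ≤ 2)]]
      exact Real.sqrt_lt_sqrt (by norm_num) (by norm_num)
    calc ‖w - Complex.mk (ε * (i : ℝ)) (ε * (j : ℝ))‖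
        ≤ Real.sqrt 2 * max |(w - Complex.mk (ε * (i : ℝ)) (ε * (j : ℝ))).re|
            |(w - Complex.mk (ε * (i : ℝ)) (ε * (j : ℝ))).im| := Complex.norm_le_sqrt_two_mul_max _
      _ ≤ Real.sqrt 2 * (ε / 2) := by gcongr
      _ < 2 * (ε / 2) := by gcongr
      _ = ε := by ring

/-! ## §3 The union bound: sub-area decay ⇒ first-entrance slit avoidance -/

/-- **A past/future return is a localised one at some grid point**: if `γ v` has norm `≤ R` and the grid
is fine enough, the return at width `ε` is a localised return at width `2ε` around the grid point nearest
to `γ v`. [folklore] -/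
theorem exists_local_of_pastFutureReturn {γ : Curve ℂ} {q : ℂ} {r r' ε R : ℝ} {n : ℕ} (hε : 0 < ε)
    (hn : R ≤ ε * n) (hR : ∀ t : I, ‖γ t‖ ≤ R) (h : PastFutureReturn γ q r r' ε) :
    ∃ z ∈ grid ε n, LocalPastFutureReturn γ q r r' z (2 * ε) := by
  obtain ⟨v, τ, t', hvτ, hτt, hτ, hfirst, hguard, hret⟩ := h
  obtain ⟨z, hz, hdz⟩ := exists_mem_grid_dist_lt hε hn (hR v)
  refine ⟨z, hz, v, τ, t', hvτ, hτt, hτ, hfirst, hguard, by linarith, ?_⟩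
  calc dist (γ t') z ≤ dist (γ t') (γ v) + dist (γ v) z := dist_triangle _ _ _
    _ < ε + ε := add_lt_add hret hdz
    _ = 2 * ε := by ring

/-- **SUB-AREA DECAY ⇒ PAST/FUTURE AVOIDANCE** at `(D; a_δ, b_δ)`. Given `(q, r, θ)`: take the `r'` of
the hypothesis, a square `[-R', R']²` containing `closure D` (`R' ≥ 1`), the target
`θ' = θ / (4 (2R'+3)²)` and its `ρ₀`; choose `ε ≤ 1/2` with `2ε < ρ₀`. Eventually in `δ` the endpoints are
distinct (so lattice polylines live in `closure D`, `Negative.curve_range_subset_closure`) and every one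
of the finitely many grid centres obeys its bound at width `2ε`; the past/future return event is covered
by the localised events at the grid points (`exists_local_of_pastFutureReturn`), and
`#grid · θ' (2ε)² ≤ (2R'+3)²/ε² · θ' · 4ε² = θ`. [folklore] -/
theorem pastFutureAvoidanceAt_of_localReturnDecayAt (hab : SAW.IsEndpointApprox D a b)
    (h : LocalReturnDecayAt D a b) : PastFutureAvoidanceAt D a b := by
  intro q r θ hr hθ
  obtain ⟨r', hrr', h5, hdec⟩ := h q r hr
  -- a square containing `closure D`
  obtain ⟨R, hR⟩ := (Metric.isBounded_iff_subset_closedBall (0 : ℂ)).1 D.isBounded.closure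
  set R' : ℝ := max R 1 with hR'
  have hR'1 : 1 ≤ R' := le_max_right _ _
  have hR'0 : 0 ≤ R' := zero_le_one.trans hR'1
  have hclos : ∀ w ∈ closure D.carrier, ‖w‖ ≤ R' := fun w hw => by
    have := hR hw
    rw [mem_closedBall, dist_zero_right] at this
    exact this.trans (le_max_left _ _)
  -- the target for the localised events
  have hK : 0 < 4 * (2 * R' + 3) ^ 2 := by positivity
  set θ' : ℝ := θ / (4 * (2 * R' + 3) ^ 2) with hθ'
  have hθ'pos : 0 < θ' := div_pos hθ hK
  obtain ⟨ρ₀, hρ₀, hloc⟩ := hdec θ' hθ'pos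
  -- the width
  set ε : ℝ := min (1 / 2) (ρ₀ / 4) with hεdef
  have hε : 0 < ε := lt_min (by norm_num) (by linarith)
  have hε1 : ε ≤ 1 := (min_le_left _ _).trans (by norm_num)
  have h2ε : 2 * ε < ρ₀ := by
    have : ε ≤ ρ₀ / 4 := min_le_right _ _
    linarith
  refine ⟨ε, r', hε, hrr', h5, ?_⟩
  -- the grid
  set n : ℕ := ⌈R' / ε⌉₊ with hndef
  have hn : R' ≤ ε * n := by
    have : R' / ε ≤ n := Nat.le_ceil _
    rwa [div_le_iff₀ hε, mul_comm] at this
  have hn' : (2 * (n : ℝ) + 1) * ε ≤ 2 * R' + 3 := by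
    have hlt : (n : ℝ) < R' / ε + 1 := Nat.ceil_lt_add_one (div_nonneg hR'0 hε.le)
    have : (n : ℝ) * ε < R' + ε := by
      have := mul_lt_mul_of_pos_right hlt hε
      rwa [add_mul, one_mul, div_mul_cancel₀ _ hε.ne'] at this
    nlinarith
  -- eventually: distinct endpoints and all grid bounds at width `2ε`
  have hev : ∀ᶠ δ in 𝓝[>] (0 : ℝ), ∀ z ∈ grid ε n,
      SAW.law D.carrier δ (a δ) (b δ)
          {γ | LocalPastFutureReturn (latticeCurve γ) q r r' z (2 * ε)} ≤
        ENNReal.ofReal (θ' * (2 * ε) ^ 2) :=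
    (eventually_all_finset _).2 fun z _ => hloc (2 * ε) (by linarith) h2ε z
  filter_upwards [eventually_ne_nhdsGT hab, hev] with δ hne hz
  -- covering of the event by the localised events
  have hcover : {γ : SAW.DomainSAW D.carrier δ (a δ) (b δ) |
        PastFutureReturn (latticeCurve γ) q r r' ε} ⊆
      ⋃ z ∈ grid ε n, {γ | LocalPastFutureReturn (latticeCurve γ) q r r' z (2 * ε)} := by
    intro γ hγ
    have hrange : ∀ t : I, ‖latticeCurve γ t‖ ≤ R' := fun t => by
      refine hclos _ (curve_range_subset_closure hne γ ?_)
      rw [← mk_latticeCurve, CurveClass.range_mk]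
      exact Set.mem_range_self t
    obtain ⟨z, hz, hloc⟩ := exists_local_of_pastFutureReturn hε hn hrange hγ
    exact Set.mem_biUnion hz hloc
  -- the union bound
  calc SAW.law D.carrier δ (a δ) (b δ) {γ | PastFutureReturn (latticeCurve γ) q r r' ε}
      ≤ SAW.law D.carrier δ (a δ) (b δ)
          (⋃ z ∈ grid ε n, {γ | LocalPastFutureReturn (latticeCurve γ) q r r' z (2 * ε)}) :=
        measure_mono hcover
    _ ≤ ∑ z ∈ grid ε n, SAW.law D.carrier δ (a δ) (b δ)
          {γ | LocalPastFutureReturn (latticeCurve γ) q r r' z (2 * ε)} :=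
        measure_biUnion_finset_le _ _
    _ ≤ ∑ _z ∈ grid ε n, ENNReal.ofReal (θ' * (2 * ε) ^ 2) := Finset.sum_le_sum hz
    _ = ENNReal.ofReal ((grid ε n).card * (θ' * (2 * ε) ^ 2)) := by
        rw [Finset.sum_const, nsmul_eq_mul, ENNReal.ofReal_mul (Nat.cast_nonneg _),
          ENNReal.ofReal_natCast]
    _ ≤ ENNReal.ofReal θ := by
        refine ENNReal.ofReal_le_ofReal ?_
        have hcard := card_grid_le ε n
        have hsq : ((2 * (n : ℝ) + 1) * ε) ^ 2 ≤ (2 * R' + 3) ^ 2 :=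
          pow_le_pow_left₀ (by positivity) hn' 2
        calc ((grid ε n).card : ℝ) * (θ' * (2 * ε) ^ 2)
            ≤ (2 * (n : ℝ) + 1) ^ 2 * (θ' * (2 * ε) ^ 2) := by gcongr
          _ = 4 * θ' * ((2 * (n : ℝ) + 1) * ε) ^ 2 := by ring
          _ ≤ 4 * θ' * (2 * R' + 3) ^ 2 := by gcongr
          _ = θ := by rw [hθ']; field_simp

/-- **Sub-area decay along every endpoint approximation ⇒ `PastFutureAvoidance`.** [folklore] -/
theorem pastFutureAvoidance_of_localReturnDecay (h : LocalReturnDecay) : PastFutureAvoidance :=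
  fun D a b hab => pastFutureAvoidanceAt_of_localReturnDecayAt hab (h D a b hab)

/-! ## §4 Power bounds give the sub-area decay -/

/-- **Any uniform power bound with exponent `> 2` gives the sub-area decay.** If for every `(q, r)` some
`r' ∈ (r, 5r]`, `c > 0`, `C ≥ 0`, `ρ₁ > 0` satisfy `P_δ[LocalPastFutureReturn … z ρ] ≤ C ρ^{2+c}` for all
`ρ ∈ (0, ρ₁)`, all `z`, eventually in `δ`, then `LocalReturnDecayAt D a b` (`C ρ^{2+c} = (C ρ^c) ρ²` and
`C ρ^c ≤ θ` once `ρ ≤ (θ/C)^{1/c}`). [folklore] -/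
theorem localReturnDecayAt_of_powerBound
    (h : ∀ (q : ℂ) (r : ℝ), 0 < r → ∃ r' c C ρ₁ : ℝ, r < r' ∧ r' ≤ 5 * r ∧ 0 < c ∧ 0 ≤ C ∧ 0 < ρ₁ ∧
      ∀ ρ : ℝ, 0 < ρ → ρ < ρ₁ → ∀ z : ℂ, ∀ᶠ δ in 𝓝[>] (0 : ℝ),
        SAW.law D.carrier δ (a δ) (b δ) {γ | LocalPastFutureReturn (latticeCurve γ) q r r' z ρ} ≤
          ENNReal.ofReal (C * ρ ^ (2 + c))) :
    LocalReturnDecayAt D a b := by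
  intro q r hr
  obtain ⟨r', c, C, ρ₁, hrr', h5, hc, hC, hρ₁, hb⟩ := h q r hr
  refine ⟨r', hrr', h5, fun θ hθ => ?_⟩
  -- `C ρ^c → 0` as `ρ → 0⁺`: pick `ρ₀ ≤ ρ₁` with `C ρ^c < θ` on `(0, ρ₀)`
  have htend : Tendsto (fun ρ : ℝ => C * ρ ^ c) (𝓝[>] (0 : ℝ)) (𝓝 0) := by
    have h0 : Tendsto (fun ρ : ℝ => ρ ^ c) (𝓝[>] (0 : ℝ)) (𝓝 0) := by
      have := (Real.continuousAt_rpow_const 0 c (Or.inr hc.le)).tendsto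
      rw [Real.zero_rpow hc.ne'] at this
      exact this.mono_left nhdsWithin_le_nhds
    simpa using h0.const_mul C
  have hevt : ∀ᶠ ρ in 𝓝[>] (0 : ℝ), C * ρ ^ c < θ := htend (Iio_mem_nhds hθ)
  have hevρ₁ : ∀ᶠ ρ in 𝓝[>] (0 : ℝ), ρ < ρ₁ := by
    filter_upwards [Ioo_mem_nhdsGT hρ₁] with ρ hρ using hρ.2
  obtain ⟨ρ₀, hρ₀, hρ₀p⟩ := (nhdsGT_basis (0 : ℝ)).eventually_iff.1 (hevt.and hevρ₁)
  -- `hρ₀p : ∀ x ∈ Ioo 0 ρ₀, C * x ^ c < θ ∧ x < ρ₁`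
  refine ⟨ρ₀, hρ₀, fun ρ hρ hρlt z => ?_⟩
  obtain ⟨hθρ, hρ₁ρ⟩ := hρ₀p ⟨hρ, hρlt⟩
  filter_upwards [hb ρ hρ hρ₁ρ z] with δ hδ
  refine hδ.trans (ENNReal.ofReal_le_ofReal ?_)
  have : C * ρ ^ (2 + c) = C * ρ ^ c * ρ ^ 2 := by
    rw [Real.rpow_add hρ, Real.rpow_two]; ring
  rw [this]
  exact mul_le_mul_of_nonneg_right hθρ.le (sq_nonneg _)

/-! ## §5 Corollaries: the crux and the summit conjunct from the exponent-type input -/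

/-- **The crux from the exponent-type ORDER input and the BOUNDARY input** (A-side-free). [folklore] -/
theorem simpleSubseqLimits_of_localReturnDecay (h : LocalReturnDecay) (hB : BoundaryDecay) :
    SimpleSubseqLimits :=
  simpleSubseqLimits_of_pastFutureAvoidance (pastFutureAvoidance_of_localReturnDecay h) hB

/-- **The crux from the exponent-type ORDER input and the A-side crux** (inside the routes; no
tightness). [folklore] -/
theorem simpleSubseqLimits_of_localReturnDecay_avoidanceLimit (h : LocalReturnDecay)
    (hA : AvoidanceLimit) : SimpleSubseqLimits :=
  line_pastFuture_avoidanceLimit (pastFutureAvoidance_of_localReturnDecay h) hA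

/-- **The summit conjunct from the exponent-type ORDER input, the A-side crux and tightness.**
[folklore] -/
theorem sawScalingLimit_of_localReturnDecay (hA : AvoidanceLimit) (h : LocalReturnDecay)
    (hT : EventualTight) : _root_.SAWScalingLimit :=
  sawScalingLimit_of_three_inputs hA (pastFutureAvoidance_of_localReturnDecay h) hT

/-- **Registered form (stub `stub_exponentInterface` of the crux item stmt-CriticalPhenomena-4982).**
Sub-area decay of localised first-entrance past/future returns (the exponent-type form of the ORDER
input: `P_δ ≤ θ ρ²` for small `ρ`, uniformly in the centre, eventually in `δ`) implies first-entrance slit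
avoidance, the residual of the crux. [folklore] -/
theorem stub_exponentInterface : LocalReturnDecay → PastFutureAvoidance :=
  pastFutureAvoidance_of_localReturnDecay

end Summit.CriticalPhenomena.SAWScalingLimit.Theorems.SimpleSubseqLimits.FarPast.Exponent

end
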